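import Literature.Analysis.FluidPDE.DEIJShearStage
import Mathlib.Analysis.SpecialFunctions.SmoothTransition
import HarnessLib

/-!
# K1-Q1 laminate step, part 1: smooth periodic WINDOW profiles (1-D toolkit)

Cell `pub-nsfunc` (host summit NavierStokesRegularity, topic `FunctionalMining`), prove seat gen 6, for the
`LaminateStep` node of the dictionary's `StretchingLaminateStep.lean` (dict BLUEPRINT
`StretchingLaminateStep.BLUEPRINT.md`). **Search for candidate a priori estimates; no regularity claim.**
Pure one-dimensional calculus; nothing about Navier–Stokes.

* `contDiff_comp_fract`: `y ↦ F(fract y)` is smooth when `F` is smooth and vanishes near `0` and near `1`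
  (the gluing principle behind the literature's `DEIJ.slopeWave`).
* `WinData.window : ShearProfile` — the smooth `1`-periodic plateau profile
  `t ↦ S((fract t − a)/ε)·S((b + ε − fract t)/ε)` (`S = Real.smoothTransition`): values in `[0,1]`,
  `= 0` for `fract t ≤ a` and for `b + ε ≤ fract t`, `= 1` for `a + ε ≤ fract t ≤ b`.
* period integrals of plateau functions: `integral_sandwich` (`d₁ − c₁ ≤ ∫₀¹ f ≤ d₀ − c₀`) and
  `abs_integral_comp_sub_le` (a `[0,1]`-valued profile that is two-valued off a set of length `ℓ` integrates
  any bounded `Q ∘ f` to `(plateau lengths)·Q(1), Q(0)` up to `ℓ·sup|Q|`).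
* `subConst`, `primitive` (periodic primitive of a mean-zero profile, `(primitive P).D = P`).
-/

noncomputable section

open MeasureTheory Set Filter Topology Function intervalIntegral
open scoped ContDiff

namespace Summit.NavierStokesRegularity.FunctionalMining

open Literature.Analysis Literature.Analysis.FunctionSpaces Literature.Analysis.FunctionSpaces.Torus

namespace LaminateWindow

/-! ## 1. Smooth functions of the fractional part -/

/-- **Gluing principle**: if `F : ℝ → ℝ` is smooth and vanishes on `(−∞, η]` and on `[1 − η, ∞)` for some
`η > 0`, then `y ↦ F (fract y)` is smooth on `ℝ` (near an integer it is identically zero, elsewhere `fract` is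
a translate of the identity). [folklore] -/
theorem contDiff_comp_fract {F : ℝ → ℝ} (hF : ContDiff ℝ ∞ F) {η : ℝ} (hη : 0 < η)
    (h0 : ∀ z, z ≤ η → F z = 0) (h1 : ∀ z, 1 - η ≤ z → F z = 0) :
    ContDiff ℝ ∞ (fun y => F (Int.fract y)) := by
  refine contDiff_iff_contDiffAt.2 fun y => ?_
  set n : ℤ := ⌊y⌋ with hn
  by_cases hy : Int.fract y = 0
  · -- near an integer the function vanishes identically
    have hyn : y = n := by have h := hy; rw [Int.fract, sub_eq_zero] at h; exact h
    set η' : ℝ := min η 1 with hη'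
    have hη'0 : 0 < η' := lt_min hη one_pos
    have hη'1 : η' ≤ 1 := min_le_right _ _
    have hη'η : η' ≤ η := min_le_left _ _
    have hev : (fun y => F (Int.fract y)) =ᶠ[𝓝 y] fun _ => (0 : ℝ) := by
      filter_upwards [Ioo_mem_nhds (show y - η' < y by linarith) (show y < y + η' by linarith)] with z hz
      rcases le_or_gt y z with hzn | hzn
      · have hfl : ⌊z⌋ = n := Int.floor_eq_iff.2 ⟨by rw [← hyn]; exact hzn, by rw [← hyn]; linarith [hz.2]⟩
        have hfr : Int.fract z = z - y := by rw [Int.fract, hfl, hyn]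
        exact h0 _ (by rw [hfr]; linarith [hz.2])
      · have hfl : ⌊z⌋ = n - 1 :=
          Int.floor_eq_iff.2 ⟨by push_cast; rw [← hyn]; linarith [hz.1], by push_cast; rw [← hyn]; linarith⟩
        have hfr : Int.fract z = z - y + 1 := by rw [Int.fract, hfl, hyn]; push_cast; ring
        exact h1 _ (by rw [hfr]; linarith [hz.1])
    exact (contDiffAt_const (c := (0 : ℝ))).congr_of_eventuallyEq hev
  · -- away from the integers `fract z = z − n` locally
    have hlo : (n : ℝ) < y := lt_of_le_of_ne (Int.floor_le y) fun h => hy (by rw [Int.fract, ← hn, ← h, sub_self])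
    have hhi : y < n + 1 := Int.lt_floor_add_one y
    have hev : (fun y => F (Int.fract y)) =ᶠ[𝓝 y] fun z => F (z - n) := by
      filter_upwards [Ioo_mem_nhds hlo hhi] with z hz
      have hfl : ⌊z⌋ = n := Int.floor_eq_iff.2 ⟨hz.1.le, hz.2⟩
      simp only [Int.fract, hfl]
    exact ((hF.comp (contDiff_id.sub contDiff_const)).contDiffAt).congr_of_eventuallyEq hev

/-! ## 2. The window generator on `ℝ` and the periodic window profile -/

/-- The window generator `S((z − a)/ε)·S((b + ε − z)/ε)` on `ℝ`. [ours; bookkeeping] -/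
def winFun (a b ε : ℝ) (z : ℝ) : ℝ :=
  Real.smoothTransition ((z - a) / ε) * Real.smoothTransition ((b + ε - z) / ε)

/-- The generator is smooth. [folklore] -/
theorem contDiff_winFun (a b ε : ℝ) : ContDiff ℝ ∞ (winFun a b ε) := by
  unfold winFun
  exact (Real.smoothTransition.contDiff.comp ((contDiff_id.sub contDiff_const).div_const _)).mul
    (Real.smoothTransition.contDiff.comp ((contDiff_const.sub contDiff_id).div_const _))

/-- `0 ≤ winFun ≤ 1`. [folklore] -/
theorem winFun_mem (a b ε z : ℝ) : winFun a b ε z ∈ Icc (0 : ℝ) 1 := by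
  unfold winFun
  exact ⟨mul_nonneg (Real.smoothTransition.nonneg _) (Real.smoothTransition.nonneg _),
    mul_le_one₀ (Real.smoothTransition.le_one _) (Real.smoothTransition.nonneg _) (Real.smoothTransition.le_one _)⟩

/-- The generator vanishes left of `a`. [folklore] -/
theorem winFun_eq_zero_of_le {a b ε z : ℝ} (hε : 0 < ε) (hz : z ≤ a) : winFun a b ε z = 0 := by
  unfold winFun
  rw [Real.smoothTransition.zero_of_nonpos (div_nonpos_of_nonpos_of_nonneg (by linarith) hε.le), zero_mul]

/-- The generator vanishes right of `b + ε`. [folklore] -/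
theorem winFun_eq_zero_of_ge {a b ε z : ℝ} (hε : 0 < ε) (hz : b + ε ≤ z) : winFun a b ε z = 0 := by
  unfold winFun
  rw [Real.smoothTransition.zero_of_nonpos (x := (b + ε - z) / ε)
    (div_nonpos_of_nonpos_of_nonneg (by linarith) hε.le), mul_zero]

/-- The generator is `1` on `[a + ε, b]`. [folklore] -/
theorem winFun_eq_one {a b ε z : ℝ} (hε : 0 < ε) (h1 : a + ε ≤ z) (h2 : z ≤ b) : winFun a b ε z = 1 := by
  unfold winFun
  rw [Real.smoothTransition.one_of_one_le ((one_le_div hε).2 (by linarith)),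
    Real.smoothTransition.one_of_one_le ((one_le_div hε).2 (by linarith)), mul_one]

/-- Admissible window data: `0 < a ≤ b`, `b + ε < 1`, `ε > 0`. [ours; bookkeeping] -/
structure WinData where
  /-- left end of the support -/
  a : ℝ
  /-- right end of the plateau -/
  b : ℝ
  /-- ramp width -/
  ε : ℝ
  /-- the support stays away from `0` -/
  ha : 0 < a
  /-- ordering -/
  hab : a ≤ b
  /-- the support stays away from `1` -/
  hb : b + ε < 1
  /-- positive ramp width -/
  hε : 0 < ε

namespace WinData

variable (w : WinData)

/-- **The window profile** `t ↦ winFun a b ε (fract t)` of admissible window data: a smooth `1`-periodic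
plateau function. [ours] -/
def window : ShearProfile where
  toFun := fun t => winFun w.a w.b w.ε (Int.fract t)
  periodic' := fun t => by simp only [Int.fract_add_one]
  contDiff' := by
    have hb' : 0 < 1 - (w.b + w.ε) := by linarith [w.hb]
    have hη : 0 < min w.a (1 - (w.b + w.ε)) := lt_min w.ha hb'
    refine contDiff_comp_fract (contDiff_winFun w.a w.b w.ε) hη (fun z hz => ?_) (fun z hz => ?_)
    · exact winFun_eq_zero_of_le w.hε (hz.trans (min_le_left _ _))
    · exact winFun_eq_zero_of_ge w.hε (by linarith [min_le_right w.a (1 - (w.b + w.ε))])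

/-- Values of the window profile. [ours; bookkeeping] -/
theorem window_apply (t : ℝ) : w.window t = winFun w.a w.b w.ε (Int.fract t) := rfl

/-- `0 ≤ window ≤ 1`. [folklore] -/
theorem window_mem (t : ℝ) : w.window t ∈ Icc (0 : ℝ) 1 := winFun_mem _ _ _ _

/-- The window vanishes where `fract t ≤ a`. [ours] -/
theorem window_eq_zero_of_le {t : ℝ} (ht : Int.fract t ≤ w.a) : w.window t = 0 :=
  winFun_eq_zero_of_le w.hε ht

/-- The window vanishes where `b + ε ≤ fract t`. [ours] -/
theorem window_eq_zero_of_ge {t : ℝ} (ht : w.b + w.ε ≤ Int.fract t) : w.window t = 0 :=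
  winFun_eq_zero_of_ge w.hε ht

/-- The window is `1` where `a + ε ≤ fract t ≤ b`. [ours] -/
theorem window_eq_one {t : ℝ} (h1 : w.a + w.ε ≤ Int.fract t) (h2 : Int.fract t ≤ w.b) : w.window t = 1 :=
  winFun_eq_one w.hε h1 h2

/-- Where the window is nonzero, `a < fract t < b + ε`. [ours] -/
theorem fract_mem_of_window_ne_zero {t : ℝ} (h : w.window t ≠ 0) : Int.fract t ∈ Ioo w.a (w.b + w.ε) := by
  by_contra hc
  rw [mem_Ioo, not_and_or, not_lt, not_lt] at hc
  rcases hc with hc | hc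
  · exact h (w.window_eq_zero_of_le hc)
  · exact h (w.window_eq_zero_of_ge hc)

/-- On `[0, 1]` the window profile is the generator itself (also at `t = 1`, where both vanish). [ours] -/
theorem window_eq_winFun {t : ℝ} (ht : t ∈ Icc (0 : ℝ) 1) : w.window t = winFun w.a w.b w.ε t := by
  rcases ht.2.eq_or_lt with h1 | h1
  · have hb1 : w.b + w.ε ≤ 1 := w.hb.le
    rw [h1, window_apply, Int.fract_one, winFun_eq_zero_of_le w.hε w.ha.le, winFun_eq_zero_of_ge w.hε hb1]
  · rw [window_apply, Int.fract_eq_self.2 ⟨ht.1, h1⟩]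

/-- The window is `1` on the real interval `[a + ε, b] ⊂ [0,1]`. [ours] -/
theorem window_eq_one_of_mem {t : ℝ} (ht : t ∈ Icc (w.a + w.ε) w.b) : w.window t = 1 := by
  have h0 : 0 ≤ t := by linarith [ht.1, w.ha, w.hε]
  have h1 : t < 1 := by linarith [ht.2, w.hb, w.hε]
  exact w.window_eq_one (by rw [Int.fract_eq_self.2 ⟨h0, h1⟩]; exact ht.1)
    (by rw [Int.fract_eq_self.2 ⟨h0, h1⟩]; exact ht.2)

/-- The window is `0` on the real interval `[0, a]`. [ours] -/
theorem window_eq_zero_of_mem_left {t : ℝ} (ht : t ∈ Icc 0 w.a) : w.window t = 0 := by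
  have h1 : t < 1 := by linarith [ht.2, w.hab, w.hb, w.hε]
  exact w.window_eq_zero_of_le (by rw [Int.fract_eq_self.2 ⟨ht.1, h1⟩]; exact ht.2)

/-- The window is `0` on the real interval `[b + ε, 1]`. [ours] -/
theorem window_eq_zero_of_mem_right {t : ℝ} (ht : t ∈ Icc (w.b + w.ε) 1) : w.window t = 0 := by
  rw [w.window_eq_winFun ⟨by linarith [ht.1, w.ha, w.hab, w.hε], ht.2⟩]
  exact winFun_eq_zero_of_ge w.hε ht.1

end WinData


/-! ## 3. Period integrals of plateau functions -/

/-- **Sandwich for period integrals of a plateau function**: if `0 ≤ f ≤ 1` on `[0,1]`, `f = 1` on `[c₁, d₁]`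
and `f = 0` on `[0, c₀] ∪ [d₀, 1]` (`0 ≤ c₀ ≤ c₁ ≤ d₁ ≤ d₀ ≤ 1`), then `d₁ − c₁ ≤ ∫₀¹ f ≤ d₀ − c₀`.
[folklore] -/
theorem integral_sandwich {f : ℝ → ℝ} (hf : Continuous f) {c₀ c₁ d₁ d₀ : ℝ} (h0 : 0 ≤ c₀) (h01 : c₀ ≤ c₁)
    (h1 : c₁ ≤ d₁) (h10 : d₁ ≤ d₀) (hd : d₀ ≤ 1) (hmem : ∀ t ∈ Icc (0 : ℝ) 1, f t ∈ Icc (0 : ℝ) 1)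
    (hone : ∀ t ∈ Icc c₁ d₁, f t = 1) (hzero₀ : ∀ t ∈ Icc 0 c₀, f t = 0) (hzero₁ : ∀ t ∈ Icc d₀ 1, f t = 0) :
    d₁ - c₁ ≤ ∫ t in (0 : ℝ)..1, f t ∧ ∫ t in (0 : ℝ)..1, f t ≤ d₀ - c₀ := by
  have hi : ∀ u v : ℝ, IntervalIntegrable f volume u v := fun u v => hf.intervalIntegrable u v
  constructor
  · -- lower bound: drop `[0, c₁]` and `[d₁, 1]`
    have hs : ∫ t in (0 : ℝ)..1, f t = (∫ t in (0 : ℝ)..c₁, f t) + ((∫ t in c₁..d₁, f t) + ∫ t in d₁..(1 : ℝ), f t) := by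
      rw [integral_add_adjacent_intervals (hi _ _) (hi _ _), integral_add_adjacent_intervals (hi _ _) (hi _ _)]
    have hA : 0 ≤ ∫ t in (0 : ℝ)..c₁, f t :=
      integral_nonneg (by linarith) fun t ht => (hmem t ⟨ht.1, by linarith [ht.2]⟩).1
    have hC : 0 ≤ ∫ t in d₁..(1 : ℝ), f t :=
      integral_nonneg (by linarith) fun t ht => (hmem t ⟨by linarith [ht.1], ht.2⟩).1
    have hB : ∫ t in c₁..d₁, f t = d₁ - c₁ := by
      rw [integral_congr (g := fun _ => (1 : ℝ)) fun t ht => ?_, intervalIntegral.integral_const, smul_eq_mul, mul_one]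
      rw [uIcc_of_le h1] at ht; exact hone t ht
    linarith
  · -- upper bound: the two outer pieces vanish, the middle one is at most its length
    have hs : ∫ t in (0 : ℝ)..1, f t = (∫ t in (0 : ℝ)..c₀, f t) + ((∫ t in c₀..d₀, f t) + ∫ t in d₀..(1 : ℝ), f t) := by
      rw [integral_add_adjacent_intervals (hi _ _) (hi _ _), integral_add_adjacent_intervals (hi _ _) (hi _ _)]
    have hA : ∫ t in (0 : ℝ)..c₀, f t = 0 := by
      rw [integral_congr (g := fun _ => (0 : ℝ)) fun t ht => ?_, intervalIntegral.integral_zero]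
      rw [uIcc_of_le h0] at ht; exact hzero₀ t ht
    have hC : ∫ t in d₀..(1 : ℝ), f t = 0 := by
      rw [integral_congr (g := fun _ => (0 : ℝ)) fun t ht => ?_, intervalIntegral.integral_zero]
      rw [uIcc_of_le hd] at ht; exact hzero₁ t ht
    have hB : ∫ t in c₀..d₀, f t ≤ d₀ - c₀ := by
      have h : (∫ t in c₀..d₀, f t) ≤ ∫ _ in c₀..d₀, (1 : ℝ) :=
        integral_mono_on (by linarith) (hi c₀ d₀) intervalIntegrable_const
          fun t ht => (hmem t ⟨by linarith [ht.1], by linarith [ht.2]⟩).2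
      rwa [intervalIntegral.integral_const, smul_eq_mul, mul_one] at h
    linarith

/-- **Two-valued plateau functions under a bounded observable**: with `f` as in `integral_sandwich` and
`|Q s| ≤ K` for `s ∈ [0,1]`,
`|∫₀¹ Q(f t) dt − ((d₁ − c₁)·Q 1 + (c₀ + 1 − d₀)·Q 0)| ≤ ((c₁ − c₀) + (d₀ − d₁))·K`. [folklore] -/
theorem abs_integral_comp_sub_le {f : ℝ → ℝ} (hf : Continuous f) {Q : ℝ → ℝ} (hQ : Continuous Q) {K : ℝ}
    (hK : ∀ s ∈ Icc (0 : ℝ) 1, |Q s| ≤ K) {c₀ c₁ d₁ d₀ : ℝ} (h0 : 0 ≤ c₀) (h01 : c₀ ≤ c₁)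
    (h1 : c₁ ≤ d₁) (h10 : d₁ ≤ d₀) (hd : d₀ ≤ 1) (hmem : ∀ t ∈ Icc (0 : ℝ) 1, f t ∈ Icc (0 : ℝ) 1)
    (hone : ∀ t ∈ Icc c₁ d₁, f t = 1) (hzero₀ : ∀ t ∈ Icc 0 c₀, f t = 0) (hzero₁ : ∀ t ∈ Icc d₀ 1, f t = 0) :
    |(∫ t in (0 : ℝ)..1, Q (f t)) - ((d₁ - c₁) * Q 1 + (c₀ + (1 - d₀)) * Q 0)| ≤ ((c₁ - c₀) + (d₀ - d₁)) * K := by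
  have hc : Continuous fun t => Q (f t) := hQ.comp hf
  have hi : ∀ u v : ℝ, IntervalIntegrable (fun t => Q (f t)) volume u v := fun u v => hc.intervalIntegrable u v
  have hK0 : 0 ≤ K := (abs_nonneg _).trans (hK 0 ⟨le_rfl, zero_le_one⟩)
  -- split `[0,1]` at `c₀, c₁, d₁, d₀`
  have hs : ∫ t in (0 : ℝ)..1, Q (f t) = (∫ t in (0 : ℝ)..c₀, Q (f t)) + ((∫ t in c₀..c₁, Q (f t)) +
      ((∫ t in c₁..d₁, Q (f t)) + ((∫ t in d₁..d₀, Q (f t)) + ∫ t in d₀..(1 : ℝ), Q (f t)))) := by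
    rw [integral_add_adjacent_intervals (hi _ _) (hi _ _), integral_add_adjacent_intervals (hi _ _) (hi _ _),
      integral_add_adjacent_intervals (hi _ _) (hi _ _), integral_add_adjacent_intervals (hi _ _) (hi _ _)]
  have hA : ∫ t in (0 : ℝ)..c₀, Q (f t) = c₀ * Q 0 := by
    rw [integral_congr (g := fun _ => Q 0) fun t ht => ?_, intervalIntegral.integral_const, smul_eq_mul, sub_zero]
    rw [uIcc_of_le h0] at ht; simp only [hzero₀ t ht]
  have hC : ∫ t in c₁..d₁, Q (f t) = (d₁ - c₁) * Q 1 := by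
    rw [integral_congr (g := fun _ => Q 1) fun t ht => ?_, intervalIntegral.integral_const, smul_eq_mul]
    rw [uIcc_of_le h1] at ht; simp only [hone t ht]
  have hE : ∫ t in d₀..(1 : ℝ), Q (f t) = (1 - d₀) * Q 0 := by
    rw [integral_congr (g := fun _ => Q 0) fun t ht => ?_, intervalIntegral.integral_const, smul_eq_mul]
    rw [uIcc_of_le hd] at ht; simp only [hzero₁ t ht]
  have hbound : ∀ u v : ℝ, 0 ≤ u → u ≤ v → v ≤ 1 → |∫ t in u..v, Q (f t)| ≤ (v - u) * K := by
    intro u v hu huv hv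
    have h := norm_integral_le_of_norm_le_const (a := u) (b := v) (C := K) (f := fun t => Q (f t)) fun t ht => ?_
    · rw [Real.norm_eq_abs, abs_of_nonneg (show 0 ≤ v - u by linarith), mul_comm] at h
      exact h
    · rw [uIoc_of_le huv] at ht
      rw [Real.norm_eq_abs]
      exact hK _ (hmem t ⟨by linarith [ht.1], ht.2.trans hv⟩)
  have hB := hbound c₀ c₁ h0 h01 (by linarith)
  have hD := hbound d₁ d₀ (by linarith) h10 hd
  rw [hs, hA, hC, hE]
  have e : c₀ * Q 0 + ((∫ t in c₀..c₁, Q (f t)) + ((d₁ - c₁) * Q 1 + ((∫ t in d₁..d₀, Q (f t)) + (1 - d₀) * Q 0))) -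
      ((d₁ - c₁) * Q 1 + (c₀ + (1 - d₀)) * Q 0) = (∫ t in c₀..c₁, Q (f t)) + ∫ t in d₁..d₀, Q (f t) := by ring
  rw [e]
  calc |(∫ t in c₀..c₁, Q (f t)) + ∫ t in d₁..d₀, Q (f t)| ≤ |∫ t in c₀..c₁, Q (f t)| + |∫ t in d₁..d₀, Q (f t)| :=
        abs_add_le _ _
    _ ≤ (c₁ - c₀) * K + (d₀ - d₁) * K := add_le_add hB hD
    _ = ((c₁ - c₀) + (d₀ - d₁)) * K := by ring

/-! ## 4. Constant shifts and periodic primitives of profiles -/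

/-- The profile `t ↦ P t − c`. [folklore] -/
def subConst (P : ShearProfile) (c : ℝ) : ShearProfile where
  toFun := fun t => P t - c
  periodic' := fun t => by simp only [P.periodic t]
  contDiff' := P.contDiff.sub contDiff_const

/-- Values of `P − c`. [folklore] -/
@[simp] theorem subConst_apply (P : ShearProfile) (c t : ℝ) : subConst P c t = P t - c := rfl

/-- **The periodic primitive** `t ↦ ∫₀ᵗ P` of a profile with `∫₀¹ P = 0`. [folklore] -/
def primitive (P : ShearProfile) (h0 : ∫ t in (0 : ℝ)..1, P t = 0) : ShearProfile where
  toFun := fun t => ∫ s in (0 : ℝ)..t, P s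
  periodic' := fun t => by
    have hi : ∀ u v : ℝ, IntervalIntegrable P volume u v := fun u v => P.continuous.intervalIntegrable u v
    have h1 : ∫ s in t..t + 1, P s = 0 := by rw [P.periodic.intervalIntegral_add_eq t 0, zero_add, h0]
    show ∫ s in (0 : ℝ)..t + 1, P s = ∫ s in (0 : ℝ)..t, P s
    rw [← integral_add_adjacent_intervals (hi 0 t) (hi t (t + 1)), h1, add_zero]
  contDiff' := by
    have hd : ∀ t, HasDerivAt (fun t => ∫ s in (0 : ℝ)..t, P s) (P t) t := fun t =>
      (P.continuous.integral_hasStrictDerivAt 0 t).hasDerivAt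
    rw [contDiff_infty_iff_deriv]
    refine ⟨fun t => (hd t).differentiableAt, ?_⟩
    rw [show deriv (fun t => ∫ s in (0 : ℝ)..t, P s) = P from funext fun t => (hd t).deriv]
    exact P.contDiff

/-- Values of the primitive. [folklore] -/
theorem primitive_apply (P : ShearProfile) (h0 : ∫ t in (0 : ℝ)..1, P t = 0) (t : ℝ) :
    primitive P h0 t = ∫ s in (0 : ℝ)..t, P s := rfl

/-- **`(∫₀ᵗ P)' = P`**: the derivative profile of the primitive is `P`. [folklore] -/
theorem deriv_primitive (P : ShearProfile) (h0 : ∫ t in (0 : ℝ)..1, P t = 0) (t : ℝ) :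
    deriv (primitive P h0) t = P t :=
  ((P.continuous.integral_hasStrictDerivAt 0 t).hasDerivAt).deriv

/-- `(primitive P).D = P` pointwise. [folklore] -/
@[simp] theorem primitive_D_apply (P : ShearProfile) (h0 : ∫ t in (0 : ℝ)..1, P t = 0) (t : ℝ) :
    (primitive P h0).D t = P t := by
  rw [ShearProfile.D_apply, deriv_primitive]

/-- `(primitive P).D.onCircle = P.onCircle`. [folklore] -/
theorem primitive_D_onCircle (P : ShearProfile) (h0 : ∫ t in (0 : ℝ)..1, P t = 0) (y : UnitAddCircle) :
    (primitive P h0).D.onCircle y = P.onCircle y := by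
  induction y using QuotientAddGroup.induction_on
  rw [ShearProfile.onCircle_coe, ShearProfile.onCircle_coe, primitive_D_apply]

end LaminateWindow

end Summit.NavierStokesRegularity.FunctionalMining

end
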